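import Summits.QuantumAdvantage.QuantumAdvantage.Theorems.HankelLiftBeyondRectanglesForsterOpt
import Summits.QuantumAdvantage.QuantumAdvantage.Theorems.HankelLiftBeyondRectanglesForsterCoercive
import Summits.QuantumAdvantage.QuantumAdvantage.Theorems.HankelLiftBeyondRectanglesForsterQuantGP
import Summits.QuantumAdvantage.QuantumAdvantage.Theorems.HankelLiftBeyondRectanglesForsterReduction

/-!
# Forster's Theorem 4.1 (radial isotropic position), proved

Route `route-QuantumAdvantage-HankelLift`.  This file assembles parts I–III
(`…ForsterOpt`, `…ForsterSpectral`/`…ForsterCoercive`, `…ForsterQuantGP`) into a proof of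
Forster's Theorem 4.1: a finite family `u : X → ℝ^k` with `|X| ≥ k` all of whose sub-families of
size `≤ k` are linearly independent is put into radial isotropic position
`∑_x (Au_x)(Au_x)ᵀ/‖Au_x‖² = (|X|/k)·I` by some nonsingular `A` (`exists_isotropic`).
Variational proof: minimize `Φ(A) = ∑_x log ‖Au_x‖² − (|X|/k) log(det A)²` over invertible `A`;
by scale invariance and coercivity (`coercive_bound` with the constant of `exists_quantGP`) a
minimizer exists on the compact set `{∑A_{ij}² = 1, det(A)² ≥ η}`; the first-order condition
(`isotropic_of_isMinOn`) is the isotropic identity.  The case `|X| = k` is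
`exists_isotropic_of_basis`.  The statement is verbatim the body of the named fact
`Literature.Computability.Complexity.ForsterIsotropicPosition`, DISCHARGED here
(`forsterIsotropicPosition_holds`); with `…ForsterReduction` this gives Forster's Theorem 2.2
unconditionally (`forster_halfspaceBound`), which makes the sign-rank rung of
`HankelLift.BeyondRectangles` unconditional (`…BeyondRectanglesSignRank.lean`).
[cite: Forster2002, Theorem 4.1]
-/

set_option linter.dupNamespace false -- D-0017: single-problem summit ⇒ `QuantumAdvantage.QuantumAdvantage` by design

noncomputable section

namespace Summit.QuantumAdvantage.QuantumAdvantage.Theorems.HankelLift.Forster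

open Finset Real Matrix

/-- Scale invariance of `Φ`: `Φ(cA) = Φ(A)` for `c ≠ 0` (when all `Au_x ≠ 0`, `det A ≠ 0`).
[folklore] -/
theorem phi_smul {X : Type*} [Fintype X] {k : ℕ} (u : X → Fin k → ℝ)
    (A : Matrix (Fin k) (Fin k) ℝ) (hne : ∀ x, A *ᵥ u x ≠ 0) (hdet : A.det ≠ 0) {c : ℝ} (hc : c ≠ 0) :
    ∑ x, Real.log ((c • A) *ᵥ u x ⬝ᵥ (c • A) *ᵥ u x) -
        (Fintype.card X : ℝ) / k * Real.log ((c • A).det ^ 2) =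
      ∑ x, Real.log (A *ᵥ u x ⬝ᵥ A *ᵥ u x) - (Fintype.card X : ℝ) / k * Real.log (A.det ^ 2) := by
  rcases Nat.eq_zero_or_pos k with hk0 | hkpos
  · subst hk0
    simp [Matrix.det_fin_zero]
  have hpos : ∀ x, 0 < A *ᵥ u x ⬝ᵥ A *ᵥ u x := fun x =>
    lt_of_le_of_ne (Finset.sum_nonneg fun l _ => mul_self_nonneg _)
      (fun h => hne x (dotProduct_self_eq_zero.mp h.symm))
  have hc2 : 0 < c ^ 2 := by positivity
  have hterm : ∀ x, Real.log ((c • A) *ᵥ u x ⬝ᵥ (c • A) *ᵥ u x) =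
      Real.log (c ^ 2) + Real.log (A *ᵥ u x ⬝ᵥ A *ᵥ u x) := by
    intro x
    rw [Matrix.smul_mulVec, smul_dotProduct, dotProduct_smul, smul_eq_mul, smul_eq_mul, ← mul_assoc,
      ← sq, Real.log_mul hc2.ne' (hpos x).ne']
  have hdet' : Real.log ((c • A).det ^ 2) = k * Real.log (c ^ 2) + Real.log (A.det ^ 2) := by
    rw [Matrix.det_smul, Fintype.card_fin, mul_pow, ← pow_mul, mul_comm k 2, pow_mul,
      Real.log_mul (pow_ne_zero _ hc2.ne') (pow_ne_zero _ hdet), Real.log_pow]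
  simp_rw [hterm]
  rw [Finset.sum_add_distrib, Finset.sum_const, Finset.card_univ, nsmul_eq_mul, hdet']
  have hk' : (k : ℝ) ≠ 0 := by exact_mod_cast hkpos.ne'
  field_simp
  ring

/-- **Forster's Theorem 4.1 (radial isotropic position).** [cite: Forster2002, Theorem 4.1] -/
theorem exists_isotropic (X : Type) [Fintype X] (k : ℕ) (u : X → Fin k → ℝ)
    (hkX : k ≤ Fintype.card X)
    (hGP : ∀ S : Finset X, S.card ≤ k → LinearIndepOn ℝ u (S : Set X)) :
    ∃ A : Matrix (Fin k) (Fin k) ℝ, IsUnit A.det ∧ ∀ w : Fin k → ℝ,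
      ∑ x, (A *ᵥ u x ⬝ᵥ w) ^ 2 / (A *ᵥ u x ⬝ᵥ A *ᵥ u x) =
        (Fintype.card X : ℝ) / k * (w ⬝ᵥ w) := by
  classical
  -- `k = 0`
  rcases Nat.eq_zero_or_pos k with hk0 | hkpos
  · subst hk0
    refine ⟨1, by simp, fun w => ?_⟩
    simp [dotProduct]
  have hk1 : 1 ≤ k := hkpos
  -- `|X| = k`
  rcases eq_or_lt_of_le hkX with heq | hlt
  · have hli : LinearIndependent ℝ u := by
      have h := hGP Finset.univ (by rw [Finset.card_univ]; exact heq.ge)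
      rw [Finset.coe_univ] at h
      exact linearIndepOn_univ_iff.mp h
    exact exists_isotropic_of_basis u heq hli
  -- `|X| > k`: the variational argument
  set n : ℕ := Fintype.card X with hndef
  have hu0 : ∀ x, u x ≠ 0 := by
    intro x
    have h := hGP {x} (by simp; exact hk1)
    rw [Finset.coe_singleton] at h
    exact h.ne_zero (Set.mem_singleton x)
  -- the functional
  let Φ : Matrix (Fin k) (Fin k) ℝ → ℝ := fun A =>
    ∑ x, Real.log (A *ᵥ u x ⬝ᵥ A *ᵥ u x) - (n : ℝ) / k * Real.log (A.det ^ 2)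
  -- nonvanishing of `A u_x` for invertible `A`
  have hAune : ∀ A : Matrix (Fin k) (Fin k) ℝ, A.det ≠ 0 → ∀ x, A *ᵥ u x ≠ 0 := by
    intro A hA x h
    have hinj := Matrix.mulVec_injective_iff_isUnit.mpr
      ((Matrix.isUnit_iff_isUnit_det A).mpr (isUnit_iff_ne_zero.mpr hA))
    exact hu0 x (hinj (h.trans (Matrix.mulVec_zero A).symm))
  -- quantitative general position and coercivity
  obtain ⟨δ₀, hδ₀, hδu, hGPq⟩ := exists_quantGP hk1 u hGP
  set C₀ : ℝ := (n : ℝ) * Real.log δ₀ - ((n : ℝ) - k) / k * Real.log k with hC₀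
  set κ : ℝ := ((n : ℝ) - k) / k ^ 2 with hκ
  have hκpos : 0 < κ := by
    rw [hκ]; apply div_pos _ (by positivity)
    rw [sub_pos]; exact_mod_cast hlt
  have hcoer : ∀ A : Matrix (Fin k) (Fin k) ℝ, ∑ i, ∑ j, A i j ^ 2 = 1 → A.det ≠ 0 →
      C₀ + κ * Real.log (1 / A.det ^ 2) ≤ Φ A := fun A hA1 hAd =>
    coercive_bound u hk1 hkX hδ₀ hδu hGPq A hA1 hAd
  -- the base point `A₁ = k^{-1/2} I`
  set A₁ : Matrix (Fin k) (Fin k) ℝ := (Real.sqrt k)⁻¹ • (1 : Matrix (Fin k) (Fin k) ℝ) with hA₁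
  have hsk : 0 < Real.sqrt k := Real.sqrt_pos.mpr (by exact_mod_cast hkpos)
  have hA₁norm : ∑ i, ∑ j, A₁ i j ^ 2 = 1 := by
    simp only [hA₁, Matrix.smul_apply, Matrix.one_apply, smul_eq_mul, mul_ite, mul_one, mul_zero]
    have : ∀ i : Fin k, ∑ j : Fin k, (if i = j then (Real.sqrt k)⁻¹ else 0) ^ 2 = ((Real.sqrt k)⁻¹) ^ 2 := by
      intro i
      rw [Finset.sum_eq_single i (fun j _ hji => by rw [if_neg (Ne.symm hji)]; ring) (by simp)]
      rw [if_pos rfl]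
    rw [Finset.sum_congr rfl fun i _ => this i, Finset.sum_const, Finset.card_univ, Fintype.card_fin,
      nsmul_eq_mul, inv_pow, Real.sq_sqrt (by positivity)]
    field_simp
  have hA₁det : A₁.det ≠ 0 := by
    rw [hA₁, Matrix.det_smul, Matrix.det_one, mul_one]
    exact pow_ne_zero _ (inv_ne_zero hsk.ne')
  -- the threshold `η`
  set η₀ : ℝ := Real.exp (-(Φ A₁ - C₀ + 1) / κ) with hη₀
  set η : ℝ := min η₀ (A₁.det ^ 2) with hη
  have hηpos : 0 < η := lt_min (Real.exp_pos _) (by positivity)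
  -- below the threshold, `Φ` exceeds `Φ A₁`
  have hbelow : ∀ A : Matrix (Fin k) (Fin k) ℝ, ∑ i, ∑ j, A i j ^ 2 = 1 → A.det ≠ 0 →
      A.det ^ 2 < η → Φ A₁ < Φ A := by
    intro A hA1 hAd hlt'
    have h1 := hcoer A hA1 hAd
    have hd2 : 0 < A.det ^ 2 := by positivity
    have hlt0 : A.det ^ 2 < η₀ := lt_of_lt_of_le hlt' (min_le_left _ _)
    -- `log(1/det²) > (Φ A₁ - C₀ + 1)/κ`
    have hlog : (Φ A₁ - C₀ + 1) / κ < Real.log (1 / A.det ^ 2) := by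
      rw [one_div, Real.log_inv]
      have := Real.log_lt_log hd2 hlt0
      rw [hη₀, Real.log_exp] at this
      have h3 : Real.log (A.det ^ 2) < -(Φ A₁ - C₀ + 1) / κ := this
      have h5 : -(Φ A₁ - C₀ + 1) / κ = -((Φ A₁ - C₀ + 1) / κ) := neg_div κ (Φ A₁ - C₀ + 1)
      linarith [h3, h5]
    have h4 : Φ A₁ - C₀ + 1 < κ * Real.log (1 / A.det ^ 2) := by
      rwa [div_lt_iff₀ hκpos, mul_comm] at hlog
    linarith
  -- the compact set
  set K : Set (Matrix (Fin k) (Fin k) ℝ) :=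
    {A | ∑ i, ∑ j, A i j ^ 2 = 1 ∧ η ≤ A.det ^ 2} with hK
  have hA₁K : A₁ ∈ K := ⟨hA₁norm, min_le_right _ _⟩
  have hKdet : ∀ A ∈ K, A.det ≠ 0 := by
    intro A hA h0
    have := hA.2; rw [h0] at this; simp at this; linarith
  have hcontF : Continuous fun A : Matrix (Fin k) (Fin k) ℝ => ∑ i, ∑ j, A i j ^ 2 :=
    continuous_finsetSum _ fun i _ => continuous_finsetSum _ fun j _ =>
      (continuous_id.matrix_elem i j).pow 2
  have hcontdet : Continuous fun A : Matrix (Fin k) (Fin k) ℝ => A.det := continuous_id.matrix_det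
  have hKclosed : IsClosed K := by
    rw [hK, Set.setOf_and]
    exact (isClosed_eq hcontF continuous_const).inter (isClosed_le continuous_const (hcontdet.pow 2))
  have hKcpt : IsCompact K := by
    have hbox : IsCompact (Set.pi Set.univ fun _ : Fin k => Set.pi Set.univ fun _ : Fin k =>
        Set.Icc (-1 : ℝ) 1 : Set (Matrix (Fin k) (Fin k) ℝ)) :=
      isCompact_univ_pi fun _ => isCompact_univ_pi fun _ => isCompact_Icc
    refine hbox.of_isClosed_subset hKclosed ?_
    intro A hA
    simp only [Set.mem_pi, Set.mem_univ, true_implies, Set.mem_Icc]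
    intro i j
    have hsq : A i j ^ 2 ≤ 1 := by
      rw [← hA.1]
      calc A i j ^ 2 ≤ ∑ j', A i j' ^ 2 :=
            Finset.single_le_sum (f := fun j' => A i j' ^ 2) (fun _ _ => sq_nonneg _) (Finset.mem_univ j)
        _ ≤ ∑ i', ∑ j', A i' j' ^ 2 :=
            Finset.single_le_sum (f := fun i' => ∑ j', A i' j' ^ 2)
              (fun _ _ => Finset.sum_nonneg fun _ _ => sq_nonneg _) (Finset.mem_univ i)
    constructor <;> nlinarith [sq_nonneg (A i j)]
  -- continuity of `Φ` on `K`
  have hΦcont : ContinuousOn Φ K := by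
    have h1 : ∀ x, ContinuousOn (fun A : Matrix (Fin k) (Fin k) ℝ =>
        Real.log (A *ᵥ u x ⬝ᵥ A *ᵥ u x)) K := by
      intro x
      have hc : Continuous fun A : Matrix (Fin k) (Fin k) ℝ => A *ᵥ u x ⬝ᵥ A *ᵥ u x :=
        (continuous_id.matrix_mulVec continuous_const).dotProduct
          (continuous_id.matrix_mulVec continuous_const)
      refine hc.continuousOn.log fun A hA => ?_
      have hne := hAune A (hKdet A hA) x
      exact (lt_of_le_of_ne (Finset.sum_nonneg fun l _ => mul_self_nonneg _)
        (fun h => hne (dotProduct_self_eq_zero.mp h.symm))).ne'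
    have h2 : ContinuousOn (fun A : Matrix (Fin k) (Fin k) ℝ => Real.log (A.det ^ 2)) K := by
      refine (hcontdet.pow 2).continuousOn.log fun A hA => ?_
      exact pow_ne_zero 2 (hKdet A hA)
    exact (continuousOn_finsetSum _ fun x _ => h1 x).sub (continuousOn_const.mul h2)
  -- a minimizer on `K`
  obtain ⟨A₀, hA₀K, hA₀min⟩ := hKcpt.exists_isMinOn ⟨A₁, hA₁K⟩ hΦcont
  have hA₀det : A₀.det ≠ 0 := hKdet A₀ hA₀K
  -- `A₀` is a global minimizer over invertible matrices
  have hglob : ∀ A : Matrix (Fin k) (Fin k) ℝ, IsUnit A.det → Φ A₀ ≤ Φ A := by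
    intro A hAunit
    have hAd : A.det ≠ 0 := hAunit.ne_zero
    set s : ℝ := Real.sqrt (∑ i, ∑ j, A i j ^ 2) with hs
    have hF0 : 0 < ∑ i, ∑ j, A i j ^ 2 := by
      by_contra hle
      have hzero : ∑ i, ∑ j, A i j ^ 2 = 0 := le_antisymm (not_lt.mp hle)
        (Finset.sum_nonneg fun _ _ => Finset.sum_nonneg fun _ _ => sq_nonneg _)
      have hA0 : A = 0 := by
        ext i j
        have h1 := (Finset.sum_eq_zero_iff_of_nonneg (fun _ _ =>
          Finset.sum_nonneg fun _ _ => sq_nonneg _)).mp hzero i (Finset.mem_univ _)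
        have h2 := (Finset.sum_eq_zero_iff_of_nonneg (fun _ _ => sq_nonneg _)).mp h1 j
          (Finset.mem_univ _)
        exact pow_eq_zero_iff (n := 2) (by norm_num) |>.mp h2
      apply hAd
      rw [hA0]
      haveI : Nonempty (Fin k) := ⟨⟨0, hkpos⟩⟩
      exact Matrix.det_zero
    have hspos : 0 < s := Real.sqrt_pos.mpr hF0
    set A' : Matrix (Fin k) (Fin k) ℝ := s⁻¹ • A with hA'
    have hA'norm : ∑ i, ∑ j, A' i j ^ 2 = 1 := by
      have happ : ∀ i j, A' i j = s⁻¹ * A i j := fun i j => rfl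
      calc ∑ i, ∑ j, A' i j ^ 2 = ∑ i, ∑ j, (s⁻¹) ^ 2 * A i j ^ 2 :=
            Finset.sum_congr rfl fun i _ => Finset.sum_congr rfl fun j _ => by rw [happ, mul_pow]
        _ = (s⁻¹) ^ 2 * ∑ i, ∑ j, A i j ^ 2 := by
            rw [Finset.mul_sum]
            exact Finset.sum_congr rfl fun i _ => by rw [Finset.mul_sum]
        _ = 1 := by rw [inv_pow, hs, Real.sq_sqrt hF0.le, inv_mul_cancel₀ hF0.ne']
    have hA'det : A'.det ≠ 0 := by
      rw [hA', Matrix.det_smul]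
      exact mul_ne_zero (pow_ne_zero _ (inv_ne_zero hspos.ne')) hAd
    have hΦeq : Φ A' = Φ A := phi_smul u A (hAune A hAd) hAd (inv_ne_zero hspos.ne')
    rw [← hΦeq]
    by_cases hcase : η ≤ A'.det ^ 2
    · exact hA₀min ⟨hA'norm, hcase⟩
    · have h := hbelow A' hA'norm hA'det (not_le.mp hcase)
      exact (hA₀min hA₁K).trans h.le
  -- the first-order condition
  refine ⟨A₀, isUnit_iff_ne_zero.mpr hA₀det, ?_⟩
  have h := isotropic_of_isMinOn u A₀ (isUnit_iff_ne_zero.mpr hA₀det) (hAune A₀ hA₀det) hglob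
  simpa [hndef] using h

/-- **Discharge of the named fact** `Literature.Computability.Complexity.ForsterIsotropicPosition`
(Forster 2002, Theorem 4.1): it holds, by `exists_isotropic`. [cite: Forster2002, Theorem 4.1] -/
theorem forsterIsotropicPosition_holds :
    Literature.Computability.Complexity.ForsterIsotropicPosition := by
  intro X _ k u hk hGP
  exact exists_isotropic X k u hk hGP

/-- **Forster's Theorem 2.2 (unconditional).**  If a `±1` matrix `M` on `X × Y` is realized by an
arrangement of homogeneous half spaces in `ℝ^ι` (`M_{xy}·⟨u_x,v_y⟩ > 0`) and `B ≥ 0` bounds the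
bilinear form `|aᵀMb| ≤ B‖a‖‖b‖` (e.g. `B = ‖M‖`), then `√(|X|·|Y|) ≤ B·|ι|`
(`halfspaceBound_of_isotropicPosition` with `forsterIsotropicPosition_holds`).
[cite: Forster2002, Theorem 2.2] -/
theorem forster_halfspaceBound :
    ∀ (X Y ι : Type) [Fintype X] [Fintype Y] [Fintype ι]
      (M : X → Y → ℝ) (u : X → ι → ℝ) (v : Y → ι → ℝ) (B : ℝ),
      0 ≤ B →
      (∀ x y, M x y = 1 ∨ M x y = -1) →
      (∀ x y, 0 < M x y * ∑ l, u x l * v y l) →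
      (∀ (a : X → ℝ) (b : Y → ℝ),
        |∑ x, ∑ y, a x * M x y * b y| ≤ B * Real.sqrt (∑ x, a x ^ 2) * Real.sqrt (∑ y, b y ^ 2)) →
      Real.sqrt ((Fintype.card X : ℝ) * (Fintype.card Y : ℝ)) ≤ B * (Fintype.card ι : ℝ) :=
  halfspaceBound_of_isotropicPosition forsterIsotropicPosition_holds

end Summit.QuantumAdvantage.QuantumAdvantage.Theorems.HankelLift.Forster
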